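import Summits.QuantumFields.YangMills.Theorems.AllWindowsColdBoxBoxHighLineSmearedFP
import Literature.MathematicalPhysics.QuantumFieldTheory.Balaban1983to89.B10Eq18SigmaSU2Haar

/-!
# TASK T-S5/U5.4b «orbit average in Pauli coordinates» — the change of variables that turns the orbit average `N_h` of the smeared
# Faddeev–Popov identity (T-S5.1, ✓`SmearedFPIdentity` task; `orbitAverage` of `…HighLineSmearedFP.lean` ✓p732501) into an integral
# over the gauge ALGEBRA at the interior sites, where the Laplace asymptotics (T-S5.4) is real analysis on `(ℝ³)^{interior}`.
# Typed obligation Prop, planner ym-idea-2 g17.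

The Literature already carries normalised Haar measure on `SU(2)` in the exponential (Pauli) chart:
`B10Eq18SigmaSU2Haar.sigmaMeasure` (= `σ_{SU(2)}(|A|) d³A` on the injectivity ball `|A| < π`, `σ(A) = (2π²)⁻¹ (sin|A|/|A|)²`),
`map_expPauli_sigmaMeasure : sigmaMeasure.map expPauli = haarProbability SU(2)`, and for finitely many factors
`measurePreserving_pi_expPauli ι : MeasurePreserving (fun A b => expPauli (A b)) (Measure.pi fun _ => sigmaMeasure) (Measure.pi fun _ => haarProbability)`.
T-S5.4b is their Bochner corollary for `interiorGaugeMeasure H = Measure.pi fun _ => haarProbability SU2`: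

  `orbitAverage H h U = ∫ A, h (U^{extendGauge H (expPauli ∘ A)}) d(Measure.pi fun _ => sigmaMeasure)`.

Proof sketch (S): `orbitAverage` is `∫ g, h (gaugeTransformZd (extendGauge H g) U) ∂(Measure.pi fun _ => haarProbability SU2)`;
rewrite with `(measurePreserving_pi_expPauli ↥(interiorSites H)).integral_comp'`-type lemma (`MeasurePreserving.integral_comp` needs a
`MeasurableEmbedding` or use `MeasurePreserving.integral_comp'`/`integral_map` with the integrand's AEStronglyMeasurable, which follows
from `Measurable h` and ✓`measurable_gaugeTransformZd_extendGauge`-type joint measurability in `…HighLineSmearedFP.lean`).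

T-S5.4b `OrbitAveragePauli` (S).

HONEST LABEL: a Prop only; nothing is proved here; S5, U5, ⟨24004⟩ ⟨24335⟩ ⟨24336⟩ remain OPEN; the Yang–Mills mass gap is NOT proved by
this file.
-/

set_option autoImplicit false

noncomputable section

open MeasureTheory Matrix
open Literature.MathematicalPhysics.QuantumFieldTheory
open Literature.MathematicalPhysics.QuantumFieldTheory.Balaban1983to89.B10Eq18SigmaSU2Haar
open Literature.MathematicalPhysics.QuantumLattice

namespace Summit.QuantumFields.YangMills.Theorems.AllWindowsColdBoxBoxHighLine

/-- Interior gauge transformation assembled from Pauli coordinates `A : interiorSites → ℝ³` (identity off the interior). -/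
def pauliGauge (H : ℕ) (A : ↥(interiorSites H) → EuclideanSpace ℝ (Fin 3)) :
    Literature.Probability.LatticeModels.Site 4 → SU2 :=
  extendGauge H fun x => expPauli (A x)

/-- T-S5.4b **(orbit average in Pauli coordinates; S)**: for measurable `h`, the orbit average over interior gauge transformations is
the integral over the gauge algebra at the interior sites against the product of the Literature's `sigmaMeasure`
(Haar of `SU(2)` pulled back to the exponential chart). -/
def OrbitAveragePauli : Prop :=
  ∀ (H : ℕ) (h : LGConfig 4 SU2 → ℝ), Measurable h → ∀ U : LGConfig 4 SU2,
    orbitAverage H h U =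
      ∫ A : ↥(interiorSites H) → EuclideanSpace ℝ (Fin 3), h (gaugeTransformZd (pauliGauge H A) U)
        ∂(Measure.pi fun _ : ↥(interiorSites H) => sigmaMeasure)

end Summit.QuantumFields.YangMills.Theorems.AllWindowsColdBoxBoxHighLine

end
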